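import Summits.FinalStateConjecture.FinalStateConjecture.Statement

/-!
# Crux `KillingSpinorEndgame` (stmt-FinalStateConjecture-17645), route `KerrnessPropagates`,
# line `registered` — registered stub `stub_flatDecomp` (DISPERSAL DECOMPOSITION, `N = 0`)

A convergent (`C²`) flat late chart `Φ : U → 𝒟` of a vacuum Cauchy development on an open
`U ⊇ {x⁰ > τ₁}`, which is a late chart into its self-determined exterior
`O₁ = J⁺(ιX) ∩ I⁻(Φ{x⁰ > τ₁})`, exhausts it at every chart time `τ ≥ τ₁`
(`O₁ \ Φ{x⁰ > τ} ⊆ J⁻(Φ{x⁰ = τ})`), and has `Φ_*∂₀` future-directed on `{x⁰ > τ₁}`, packages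
into an `N = 0` final-state decomposition `d` of `O₁` in `C²` (`flatDomain = U`, `flatChart = Φ`,
`τ₀ = τ₁`, every hole field over `Fin 0` eliminated) with: sub-extremal holes (vacuous),
`O₁ = exteriorOf 𝒟 d.charted` (`d.charted = Φ{x⁰ > τ₁} ∪ ⋃ (over Fin 0) = Φ{x⁰ > τ₁}`),
`HasExhaustiveCharts d` (radii over `Fin 0`; clause (ii) is the exhaustion hypothesis, the certified
pieces reducing to the flat ones), and `IsFutureOriented d` ((i)–(ii) vacuous over `Fin 0`; (iii)
eventually in flat time `τ > τ₁` by `eventually_gt_atTop`, from the orientation hypothesis since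
`x ∈ timeSlab τ ↔ x⁰ = τ`). This is `stub_flatDecomp : Sig.stub_flatDecomp` (explicitly
`flatDecomp`); the construction is that of the kernel-checked `decomp_of_convergentChart` (crux
stmt-14665), plus the orientation conjunct. Mathlib + the Statement cone only
(`FinalStateDecomposition`, `exteriorOf`, `HasExhaustiveCharts`, `IsFutureOriented`,
`LorentzianMetric.causalFuture_mono`); no named facts. References: M. Dafermos, J. Luk,
arXiv:1710.01722 (2017), Conjecture 1 (the `N = 0` case: dispersal); D. Christodoulou,
S. Klainerman, *The global nonlinear stability of the Minkowski space*, Princeton 1993, Thm. 1.0.2.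
-/


noncomputable section

-- `FinalStateConjecture.FinalStateConjecture` repeats summit = sub-problem (D-0017); deliberate.
set_option linter.dupNamespace false

open Literature.Geometry.Lorentzian
open scoped Manifold ContDiff Topology ENNReal
open Filter Set TopologicalSpace

namespace Summit.FinalStateConjecture.FinalStateConjecture.Theorems.KerrnessPropagates.KillingSpinorEndgame

/-! ### The registered signature and the stub -/

/-- **Signature of the registered stub `stub_flatDecomp`** — verbatim the `Prop`
`Sig.stub_flatDecomp` of the skeleton `Cruxes/KillingSpinorEndgame/Lines/registered.lean`
(crux stmt-FinalStateConjecture-17645), restated because the skeleton carries `sorry`s and is not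
importable; an OBLIGATION of the line (proved below: `stub_flatDecomp`), not a cited fact.
DISPERSAL DECOMPOSITION: a convergent (`C²`) flat late chart `Φ : U → 𝒟` on `U ⊇ {x⁰ > τ₁}`, a late
chart into its self-determined exterior `J⁺(ιX) ∩ I⁻(Φ{x⁰ > τ₁})`, exhausting it at every chart time
`τ ≥ τ₁`, with `Φ_*∂₀` future-directed on `{x⁰ > τ₁}`, gives an `N = 0` final-state decomposition
`d` of `O = exteriorOf 𝒟 d.charted` with (vacuously) sub-extremal holes, `HasExhaustiveCharts d`
and `IsFutureOriented d`. (ref: DafermosLuk2017, Conjecture 1; ChristodoulouKlainerman1993,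
Thm. 1.0.2) -/
def Sig.stub_flatDecomp : Prop :=
  ∀ (X : Type) [TopologicalSpace X] [ChartedSpace E3 X] [IsManifold (𝓡 3) ∞ X]
    [T2Space X] [SecondCountableTopology X] [ConnectedSpace X] (D : InitialDataSet (𝓡 3) X)
    (𝒟 : VacuumCauchyDevelopment D) (τ₁ : ℝ) (U : Opens E4) (Φ : U → 𝒟.carrier),
    {x : E4 | τ₁ < x 0} ⊆ (U : Set E4) →
    𝒟.toSpacetime.IsLateChart (Minkowski.backgroundOn U)
      (Summit.FinalStateConjecture.exteriorOf 𝒟.toCauchyDevelopment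
        (Φ '' (Minkowski.backgroundOn U).lateRegion τ₁)) τ₁ Φ →
    Tendsto (fun τ ↦ 𝒟.toSpacetime.deviationCk (Minkowski.backgroundOn U) Φ 2 τ) atTop (𝓝 0) →
    (∀ τ : ℝ, τ₁ ≤ τ →
      Summit.FinalStateConjecture.exteriorOf 𝒟.toCauchyDevelopment
          (Φ '' (Minkowski.backgroundOn U).lateRegion τ₁) \
        Φ '' (Minkowski.backgroundOn U).lateRegion τ ⊆
      𝒟.metric.causalPast 𝒟.timeOrientation (Φ '' (Minkowski.backgroundOn U).timeSlab τ)) →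
    (∀ y : U, τ₁ < y.1 0 →
      𝒟.timeOrientation.IsFutureDirected (mfderiv 𝓘(ℝ, E4) (𝓡 4) Φ y (E4.basisVector 0))) →
    ∃ (O : Set 𝒟.carrier) (d : FinalStateDecomposition 𝒟.toSpacetime O 2),
      (∀ i, Kerr.IsSubextremal (d.mass i) (d.spin i)) ∧
      O = Summit.FinalStateConjecture.exteriorOf 𝒟.toCauchyDevelopment d.charted ∧
      Summit.FinalStateConjecture.HasExhaustiveCharts d ∧
      Summit.FinalStateConjecture.IsFutureOriented d

/-- **Dispersal decomposition, explicit form** (`N = 0` case of the final-state picture,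
Dafermos–Luk 2017, Conjecture 1; Christodoulou–Klainerman 1993, Thm. 1.0.2). A convergent (`C²`)
flat late chart `Φ : U → 𝒟` on `U ⊇ {x⁰ > τ₁}` into its self-determined exterior
`O₁ = J⁺(ιX) ∩ I⁻(Φ{x⁰ > τ₁})`, exhausting it at every chart time `τ ≥ τ₁`, with `Φ_*∂₀`
future-directed on `{x⁰ > τ₁}`, IS the `N = 0` decomposition `d` of `O₁` (`flatDomain = U`,
`flatChart = Φ`, `τ₀ = τ₁`, hole fields over `Fin 0`): sub-extremality and clauses (i)–(ii) of
`IsFutureOriented` are vacuous, `d.charted = Φ{x⁰ > τ₁}`, the certified late region / slab of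
`HasExhaustiveCharts` are the flat ones (so its clause (ii) is the exhaustion hypothesis, through
`LorentzianMetric.causalFuture_mono`), and clause (iii) of `IsFutureOriented` holds at every flat
time `τ > τ₁` (`eventually_gt_atTop`). The construction of `decomp_of_convergentChart` (crux
stmt-14665) plus the orientation conjunct. [cite: DafermosLuk2017, Conjecture 1] -/
theorem flatDecomp {X : Type} [TopologicalSpace X] [ChartedSpace E3 X] [IsManifold (𝓡 3) ∞ X]
    [ConnectedSpace X] {D : InitialDataSet (𝓡 3) X} (𝒟 : VacuumCauchyDevelopment D) {τ₁ : ℝ}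
    {U : Opens E4} {Φ : U → 𝒟.carrier} (hU : {x : E4 | τ₁ < x 0} ⊆ (U : Set E4))
    (hlate : 𝒟.toSpacetime.IsLateChart (Minkowski.backgroundOn U)
      (Summit.FinalStateConjecture.exteriorOf 𝒟.toCauchyDevelopment
        (Φ '' (Minkowski.backgroundOn U).lateRegion τ₁)) τ₁ Φ)
    (hdev : Tendsto (fun τ ↦ 𝒟.toSpacetime.deviationCk (Minkowski.backgroundOn U) Φ 2 τ)
      atTop (𝓝 0))
    (hexh : ∀ τ : ℝ, τ₁ ≤ τ →
      Summit.FinalStateConjecture.exteriorOf 𝒟.toCauchyDevelopment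
          (Φ '' (Minkowski.backgroundOn U).lateRegion τ₁) \
        Φ '' (Minkowski.backgroundOn U).lateRegion τ ⊆
      𝒟.metric.causalPast 𝒟.timeOrientation (Φ '' (Minkowski.backgroundOn U).timeSlab τ))
    (hfut : ∀ y : U, τ₁ < y.1 0 →
      𝒟.timeOrientation.IsFutureDirected (mfderiv 𝓘(ℝ, E4) (𝓡 4) Φ y (E4.basisVector 0))) :
    ∃ (O : Set 𝒟.carrier) (d : FinalStateDecomposition 𝒟.toSpacetime O 2),
      (∀ i, Kerr.IsSubextremal (d.mass i) (d.spin i)) ∧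
      O = Summit.FinalStateConjecture.exteriorOf 𝒟.toCauchyDevelopment d.charted ∧
      Summit.FinalStateConjecture.HasExhaustiveCharts d ∧
      Summit.FinalStateConjecture.IsFutureOriented d := by
  -- adapted from `Summits/FinalStateConjecture/FinalStateConjecture/Theorems/
  --   ClusterCompletenessRecurrentlyFlatDispersesConvergentCase.lean`, `decomp_of_convergentChart`
  -- the `N = 0` decomposition of the self-determined exterior of the flat chart
  let O' : Set 𝒟.carrier := Summit.FinalStateConjecture.exteriorOf 𝒟.toCauchyDevelopment
    (Φ '' (Minkowski.backgroundOn U).lateRegion τ₁)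
  let d : FinalStateDecomposition 𝒟.toSpacetime O' 2 :=
    { N := 0
      mass := Fin.elim0
      spin := Fin.elim0
      mass_pos := fun i ↦ i.elim0
      abs_spin_le_mass := fun i ↦ i.elim0
      motion := Fin.elim0
      τ₀ := τ₁
      chart := fun i ↦ i.elim0
      isLateChart := fun i ↦ i.elim0
      tendsto_truncDeviationCk := fun i ↦ i.elim0
      exists_pairwise_disjoint := fun _ ↦ ⟨0, fun i ↦ i.elim0⟩
      excision := Fin.elim0
      tendsto_excision_div := fun i ↦ i.elim0
      flatDomain := U
      setOf_lt_excision_subset_flatDomain := fun x hx ↦ hU hx.1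
      flatChart := Φ
      isLateChart_flat := hlate
      tendsto_deviationCk_flat := hdev
      diff_subset_causalPast := by
        intro p hp
        have hp2 : p ∉ Φ '' (Minkowski.backgroundOn U).lateRegion τ₁ :=
          fun h' ↦ hp.2 (Or.inr h')
        have hJ := hexh τ₁ le_rfl ⟨hp.1, hp2⟩
        exact LorentzianMetric.causalFuture_mono subset_union_right hJ }
  refine ⟨O', d, fun i ↦ i.elim0, ?_,
    ⟨fun i ↦ i.elim0, fun i ↦ i.elim0, fun i ↦ i.elim0, fun τ hτ ↦ ?_⟩,
    ⟨fun i ↦ i.elim0, fun i ↦ i.elim0, ?_⟩⟩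
  · -- `O' = J⁺(ι X) ∩ I⁻(d.charted)`, as `d.charted = Φ '' {x⁰ > τ₁} ∪ ⋃ (over Fin 0)`
    have hch : d.charted = Φ '' (Minkowski.backgroundOn U).lateRegion τ₁ := by
      ext p
      simp only [FinalStateDecomposition.charted, Set.mem_union, Set.mem_iUnion]
      constructor
      · rintro (h' | ⟨i, -⟩)
        · exact h'
        · exact i.elim0
      · exact fun h' ↦ Or.inl h'
    rw [hch]
  · -- exhaustion at chart time `τ > τ₁`: the certified pieces are the flat ones
    intro p hp
    have hp2 : p ∉ Φ '' (Minkowski.backgroundOn U).lateRegion τ := fun h' ↦ hp.2 (Or.inl h')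
    have hJ := hexh τ (le_of_lt hτ) ⟨hp.1, hp2⟩
    exact LorentzianMetric.causalFuture_mono subset_union_left hJ
  · -- orientation clause (iii): eventually in flat time `τ > τ₁`, on the flat slab `{x⁰ = τ}`
    filter_upwards [eventually_gt_atTop τ₁] with τ hτ x hx
    have hx0 : x.1 0 = τ := hx
    exact hfut x (by rw [hx0]; exact hτ)

/-- **Registered stub `stub_flatDecomp`** (crux stmt-FinalStateConjecture-17645, line
`registered`; DISPERSAL DECOMPOSITION, `N = 0`), with the registered header `stub_flatDecomp :
Sig.stub_flatDecomp`: the explicit theorem `flatDecomp`. Dafermos–Luk 2017, Conjecture 1;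
Christodoulou–Klainerman 1993, Thm. 1.0.2. [cite: DafermosLuk2017, Conjecture 1] -/
theorem stub_flatDecomp : Sig.stub_flatDecomp :=
  fun _ _ _ _ _ _ _ _ 𝒟 _ _ _ hU hlate hdev hexh hfut ↦ flatDecomp 𝒟 hU hlate hdev hexh hfut

end Summit.FinalStateConjecture.FinalStateConjecture.Theorems.KerrnessPropagates.KillingSpinorEndgame

end
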